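import Mathlib.Analysis.InnerProductSpace.PiL2
import Mathlib.Analysis.InnerProductSpace.Calculus
import Mathlib.Analysis.SpecialFunctions.Sqrt
import Mathlib.Geometry.Manifold.ContMDiff.Atlas
import Mathlib.Geometry.Manifold.ContMDiff.NormedSpace
import HarnessLib

/-!
# Fold-adapted polar charts of `ℝ⁴ ∖ 0`

Helper file for item `FoldedSphereFoldExistence` (route SymplecticOrigami), used by the
non-vacuity witness of the named fact
`Literature.Topology.FourManifolds.eliashberg_foldMap_homotopySphere_four` at the round sphere.
For a coordinate index `i : Fin 4` and a sign `ε = ±1`, the chart `polarChart i ε` of `ℝ⁴` on the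
open half-space `{ε uᵢ > 0}`:

  `u ↦ ( (‖u‖ - 1) / (‖u‖ + 1), (u_j / ‖u‖)_{j ≠ i} )`,

a radial coordinate `t = (r - 1)/(r + 1) ∈ (-1, 1)` vanishing exactly on the unit sphere, followed
by three direction coordinates (graph coordinates of the open hemisphere `ε dᵢ > 0` of `S³`); the
inverse is `(t, a) ↦ (1 + t)/(1 - t) · d(a)` with `d(a) = a` completed by `ε √(1 - |a|²)` at slot
`i`. Both directions are `C^∞` (`contDiffOn_polarFun`, `contDiffOn_polarInv`), so these are charts
of the maximal `C^∞` atlas of `ℝ⁴` (`polarChart_mem_maximalAtlas`).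
-/

noncomputable section

-- the prescribed namespace `Summit.<P>.<Sub>.…` duplicates `SmoothPoincare4` (P = Sub)
set_option linter.dupNamespace false

open scoped Manifold ContDiff Topology
open Set Function

namespace Summit.SmoothPoincare4.SmoothPoincare4.Theorems.FoldedSphereFoldExistence

/-! ### Coordinate bookkeeping on `ℝ⁴` -/

/-- `‖u‖² = uᵢ² + Σ_{j ≠ i} u_j²`. [folklore] -/
theorem norm_sq_eq_sq_add_sum_succAbove (u : EuclideanSpace ℝ (Fin 4)) (i : Fin 4) :
    ‖u‖ ^ 2 = u i ^ 2 + ∑ k : Fin 3, u (i.succAbove k) ^ 2 := by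
  rw [EuclideanSpace.real_norm_sq_eq, Fin.sum_univ_succAbove _ i]

/-- The forward map of the polar chart: `u ↦ ((‖u‖-1)/(‖u‖+1), (u_j/‖u‖)_{j ≠ i})`. [folklore] -/
def polarFun (i : Fin 4) (u : EuclideanSpace ℝ (Fin 4)) : EuclideanSpace ℝ (Fin 4) :=
  WithLp.toLp 2 (Fin.cons ((‖u‖ - 1) / (‖u‖ + 1)) fun k : Fin 3 => u (i.succAbove k) / ‖u‖)

/-- The unit direction with `a` in the slots `j ≠ i` and `ε √(1 - |a|²)` in slot `i`. [folklore] -/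
def polarDir (i : Fin 4) (ε : ℝ) (p : EuclideanSpace ℝ (Fin 4)) : EuclideanSpace ℝ (Fin 4) :=
  WithLp.toLp 2 (Fin.insertNth i (ε * Real.sqrt (1 - ∑ k : Fin 3, p k.succ ^ 2))
    (fun k : Fin 3 => p k.succ))

/-- The inverse map of the polar chart: `(t, a) ↦ (1+t)/(1-t) · polarDir`. [folklore] -/
def polarInv (i : Fin 4) (ε : ℝ) (p : EuclideanSpace ℝ (Fin 4)) : EuclideanSpace ℝ (Fin 4) :=
  ((1 + p 0) / (1 - p 0)) • polarDir i ε p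

/-- First coordinate of `polarFun`. [folklore] -/
@[simp] theorem polarFun_apply_zero (i : Fin 4) (u : EuclideanSpace ℝ (Fin 4)) :
    polarFun i u 0 = (‖u‖ - 1) / (‖u‖ + 1) := by
  simp [polarFun]

/-- The other coordinates of `polarFun`. [folklore] -/
@[simp] theorem polarFun_apply_succ (i : Fin 4) (u : EuclideanSpace ℝ (Fin 4)) (k : Fin 3) :
    polarFun i u k.succ = u (i.succAbove k) / ‖u‖ := by
  simp [polarFun]

/-- Slot `i` of the direction. [folklore] -/
@[simp] theorem polarDir_apply_same (i : Fin 4) (ε : ℝ) (p : EuclideanSpace ℝ (Fin 4)) :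
    polarDir i ε p i = ε * Real.sqrt (1 - ∑ k : Fin 3, p k.succ ^ 2) := by
  simp [polarDir, Fin.insertNth_apply_same]

/-- Slots `j ≠ i` of the direction. [folklore] -/
@[simp] theorem polarDir_apply_succAbove (i : Fin 4) (ε : ℝ) (p : EuclideanSpace ℝ (Fin 4))
    (k : Fin 3) : polarDir i ε p (i.succAbove k) = p k.succ := by
  simp [polarDir, Fin.insertNth_apply_succAbove]

/-- Coordinates of `polarInv`. [folklore] -/
theorem polarInv_apply (i : Fin 4) (ε : ℝ) (p : EuclideanSpace ℝ (Fin 4)) (j : Fin 4) :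
    polarInv i ε p j = (1 + p 0) / (1 - p 0) * polarDir i ε p j := by
  simp [polarInv]

/-- The direction has unit norm when `|a| ≤ 1` and `ε² = 1`. [folklore] -/
theorem norm_polarDir (i : Fin 4) {ε : ℝ} (hε : ε ^ 2 = 1) (p : EuclideanSpace ℝ (Fin 4))
    (hp : ∑ k : Fin 3, p k.succ ^ 2 ≤ 1) : ‖polarDir i ε p‖ = 1 := by
  have h1 : ‖polarDir i ε p‖ ^ 2 = 1 := by
    rw [norm_sq_eq_sq_add_sum_succAbove _ i]
    simp only [polarDir_apply_same, polarDir_apply_succAbove]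
    rw [mul_pow, hε, one_mul, Real.sq_sqrt (by linarith)]
    ring
  exact (pow_eq_one_iff_of_nonneg (norm_nonneg _) two_ne_zero).1 h1

/-! ### Smoothness of the two maps -/

/-- The forward map is `C^∞` off the origin. [folklore] -/
theorem contDiffOn_polarFun (i : Fin 4) :
    ContDiffOn ℝ ∞ (polarFun i) {u : EuclideanSpace ℝ (Fin 4) | u ≠ 0} := by
  have hn : ContDiffOn ℝ ∞ (fun u : EuclideanSpace ℝ (Fin 4) => ‖u‖) {u | u ≠ 0} :=
    fun u hu => (contDiffAt_norm ℝ hu).contDiffWithinAt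
  rw [contDiffOn_euclidean]
  refine Fin.cases ?_ (fun k => ?_)
  · simp_rw [polarFun_apply_zero]
    exact (hn.sub contDiffOn_const).div (hn.add contDiffOn_const) fun u _ => by positivity
  · simp_rw [polarFun_apply_succ]
    exact (contDiff_piLp_apply (p := 2) (i := i.succAbove k)).contDiffOn.div hn
      fun u hu => norm_ne_zero_iff.2 hu

/-- The inverse map is `C^∞` where `t ≠ 1` and `|a| < 1`. [folklore] -/
theorem contDiffOn_polarInv (i : Fin 4) (ε : ℝ) :
    ContDiffOn ℝ ∞ (polarInv i ε)
      {p : EuclideanSpace ℝ (Fin 4) | p 0 < 1 ∧ ∑ k : Fin 3, p k.succ ^ 2 < 1} := by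
  have h0 : ContDiff ℝ ∞ fun p : EuclideanSpace ℝ (Fin 4) => p 0 := contDiff_piLp_apply (p := 2)
  have hs : ContDiff ℝ ∞ fun p : EuclideanSpace ℝ (Fin 4) => ∑ k : Fin 3, p k.succ ^ 2 :=
    ContDiff.sum fun k _ => (contDiff_piLp_apply (p := 2) (i := k.succ)).pow 2
  have hr : ContDiffOn ℝ ∞ (fun p : EuclideanSpace ℝ (Fin 4) => (1 + p 0) / (1 - p 0))
      {p | p 0 < 1 ∧ ∑ k : Fin 3, p k.succ ^ 2 < 1} :=
    (contDiffOn_const.add h0.contDiffOn).div (contDiffOn_const.sub h0.contDiffOn)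
      fun p hp => by have := hp.1; linarith
  have hd : ContDiffOn ℝ ∞ (polarDir i ε) {p | p 0 < 1 ∧ ∑ k : Fin 3, p k.succ ^ 2 < 1} := by
    rw [contDiffOn_euclidean]
    refine Fin.succAboveCases i ?_ (fun k => ?_)
    · simp_rw [polarDir_apply_same]
      refine contDiffOn_const.mul ?_
      exact (contDiffOn_const.sub hs.contDiffOn).sqrt fun p hp => by have := hp.2; linarith
    · simp_rw [polarDir_apply_succAbove]
      exact (contDiff_piLp_apply (p := 2) (i := k.succ)).contDiffOn
  exact hr.smul hd

/-! ### The chart -/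

/-- **The fold-adapted polar chart** of `ℝ⁴` on the half-space `{ε uᵢ > 0}` (`ε = ±1`).
[folklore] -/
def polarChart (i : Fin 4) (ε : ℝ) (hε : ε = 1 ∨ ε = -1) :
    OpenPartialHomeomorph (EuclideanSpace ℝ (Fin 4)) (EuclideanSpace ℝ (Fin 4)) where
  toFun := polarFun i
  invFun := polarInv i ε
  source := {u | 0 < ε * u i}
  target := {p | -1 < p 0 ∧ p 0 < 1 ∧ ∑ k : Fin 3, p k.succ ^ 2 < 1}
  map_source' := by
    intro u hu
    have hui : u i ≠ 0 := by
      intro h0; simp [h0] at hu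
    have hr : 0 < ‖u‖ := by
      refine norm_pos_iff.2 fun h0 => hui ?_
      simp [h0]
    refine ⟨?_, ?_, ?_⟩
    · rw [polarFun_apply_zero, lt_div_iff₀ (by linarith)]
      linarith
    · rw [polarFun_apply_zero, div_lt_iff₀ (by linarith)]
      linarith
    · simp only [polarFun_apply_succ, div_pow]
      rw [← Finset.sum_div, div_lt_one (by positivity)]
      have h := norm_sq_eq_sq_add_sum_succAbove u i
      have h2 : 0 < u i ^ 2 := by positivity
      linarith
  map_target' := by
    intro p hp
    obtain ⟨h1, h2, h3⟩ := hp
    have hε2 : ε ^ 2 = 1 := by rcases hε with h | h <;> simp [h]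
    show 0 < ε * polarInv i ε p i
    rw [polarInv_apply, polarDir_apply_same]
    have hr : 0 < (1 + p 0) / (1 - p 0) := div_pos (by linarith) (by linarith)
    have hs : 0 < Real.sqrt (1 - ∑ k : Fin 3, p k.succ ^ 2) := Real.sqrt_pos.2 (by linarith)
    have : ε * ((1 + p 0) / (1 - p 0) * (ε * Real.sqrt (1 - ∑ k : Fin 3, p k.succ ^ 2))) =
        ε ^ 2 * ((1 + p 0) / (1 - p 0)) * Real.sqrt (1 - ∑ k : Fin 3, p k.succ ^ 2) := by ring
    rw [this, hε2, one_mul]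
    exact mul_pos hr hs
  left_inv' := by
    intro u hu
    have hui : u i ≠ 0 := by
      intro h0; simp [h0] at hu
    have hr : 0 < ‖u‖ := by
      refine norm_pos_iff.2 fun h0 => hui ?_
      simp [h0]
    have hr1 : ‖u‖ + 1 ≠ 0 := by positivity
    have hr0 : ‖u‖ ≠ 0 := hr.ne'
    -- the radial coordinate inverts
    have ht : (1 + (‖u‖ - 1) / (‖u‖ + 1)) / (1 - (‖u‖ - 1) / (‖u‖ + 1)) = ‖u‖ := by
      field_simp
      ring
    -- the direction: `ε √(1 - Σ (u_j/r)²) = uᵢ / r`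
    have hsum : 1 - ∑ k : Fin 3, (u (i.succAbove k) / ‖u‖) ^ 2 = (u i / ‖u‖) ^ 2 := by
      simp only [div_pow]
      rw [← Finset.sum_div]
      have h := norm_sq_eq_sq_add_sum_succAbove u i
      field_simp
      linarith
    have hdir : ε * Real.sqrt (1 - ∑ k : Fin 3, (u (i.succAbove k) / ‖u‖) ^ 2) = u i / ‖u‖ := by
      rw [hsum, Real.sqrt_sq_eq_abs, abs_div, abs_of_pos hr]
      rcases hε with h | h
      · subst h
        have : 0 < u i := by simpa using hu
        rw [one_mul, abs_of_pos this]
      · subst h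
        have : u i < 0 := by simpa using hu
        rw [abs_of_neg this]
        ring
    have hsucc : ∀ k : Fin 3, polarFun i u k.succ = u (i.succAbove k) / ‖u‖ :=
      polarFun_apply_succ i u
    ext j
    rw [polarInv_apply, polarFun_apply_zero, ht]
    induction j using Fin.succAboveCases i with
    | x =>
      rw [polarDir_apply_same]
      simp_rw [hsucc]
      rw [hdir]
      field_simp
    | p k =>
      rw [polarDir_apply_succAbove, hsucc]
      field_simp
  right_inv' := by
    intro p hp
    obtain ⟨h1, h2, h3⟩ := hp
    have hε2 : ε ^ 2 = 1 := by rcases hε with h | h <;> simp [h]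
    have hrpos : 0 < (1 + p 0) / (1 - p 0) := div_pos (by linarith) (by linarith)
    have h1t : 1 - p 0 ≠ 0 := by linarith
    have h1t' : 1 + p 0 ≠ 0 := by linarith
    have hnorm : ‖polarInv i ε p‖ = (1 + p 0) / (1 - p 0) := by
      rw [polarInv, norm_smul, norm_polarDir i hε2 p h3.le, mul_one, Real.norm_eq_abs,
        abs_of_pos hrpos]
    ext j
    refine Fin.cases ?_ (fun k => ?_) j
    · rw [polarFun_apply_zero, hnorm]
      field_simp
      ring
    · rw [polarFun_apply_succ, hnorm, polarInv_apply, polarDir_apply_succAbove]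
      field_simp
  open_source := by
    have hc : Continuous fun u : EuclideanSpace ℝ (Fin 4) => ε * u i :=
      continuous_const.mul ((continuous_apply i).comp (PiLp.continuous_ofLp 2 _))
    exact isOpen_lt continuous_const hc
  open_target := by
    have h0 : Continuous fun p : EuclideanSpace ℝ (Fin 4) => p 0 :=
      (continuous_apply 0).comp (PiLp.continuous_ofLp 2 _)
    have hs : Continuous fun p : EuclideanSpace ℝ (Fin 4) => ∑ k : Fin 3, p k.succ ^ 2 :=
      continuous_finsetSum _ fun k _ =>
        ((continuous_apply k.succ).comp (PiLp.continuous_ofLp 2 _)).pow 2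
    exact (isOpen_lt continuous_const h0).inter ((isOpen_lt h0 continuous_const).inter
      (isOpen_lt hs continuous_const))
  continuousOn_toFun := by
    refine (contDiffOn_polarFun i).continuousOn.mono fun u hu => ?_
    intro h0
    have : (0 : ℝ) < ε * u i := hu
    simp [h0] at this
  continuousOn_invFun := by
    exact (contDiffOn_polarInv i ε).continuousOn.mono fun p hp => ⟨hp.2.1, hp.2.2⟩

/-- The polar chart as a function. [folklore] -/
@[simp] theorem polarChart_apply (i : Fin 4) (ε : ℝ) (hε : ε = 1 ∨ ε = -1)
    (u : EuclideanSpace ℝ (Fin 4)) : polarChart i ε hε u = polarFun i u := rfl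

/-- The inverse of the polar chart as a function. [folklore] -/
@[simp] theorem polarChart_symm_apply (i : Fin 4) (ε : ℝ) (hε : ε = 1 ∨ ε = -1)
    (p : EuclideanSpace ℝ (Fin 4)) : (polarChart i ε hε).symm p = polarInv i ε p := rfl

/-- The source of the polar chart. [folklore] -/
theorem polarChart_source (i : Fin 4) (ε : ℝ) (hε : ε = 1 ∨ ε = -1) :
    (polarChart i ε hε).source = {u | 0 < ε * u i} := rfl

/-- The target of the polar chart. [folklore] -/
theorem polarChart_target (i : Fin 4) (ε : ℝ) (hε : ε = 1 ∨ ε = -1) :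
    (polarChart i ε hε).target =
      {p | -1 < p 0 ∧ p 0 < 1 ∧ ∑ k : Fin 3, p k.succ ^ 2 < 1} := rfl

/-- **The polar charts belong to the maximal `C^∞` atlas of `ℝ⁴`** (both directions are `C^∞`).
[folklore] -/
theorem polarChart_mem_maximalAtlas (i : Fin 4) (ε : ℝ) (hε : ε = 1 ∨ ε = -1) :
    polarChart i ε hε ∈ IsManifold.maximalAtlas 𝓘(ℝ, EuclideanSpace ℝ (Fin 4)) ∞
      (EuclideanSpace ℝ (Fin 4)) := by
  refine (polarChart i ε hε).mem_maximalAtlas_of_contMDiffOn ?_ ?_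
  · rw [contMDiffOn_iff_contDiffOn]
    refine (contDiffOn_polarFun i).mono fun u hu => ?_
    intro h0
    have : (0 : ℝ) < ε * u i := hu
    simp [h0] at this
  · rw [contMDiffOn_iff_contDiffOn]
    exact (contDiffOn_polarInv i ε).mono fun p hp => ⟨hp.2.1, hp.2.2⟩

end Summit.SmoothPoincare4.SmoothPoincare4.Theorems.FoldedSphereFoldExistence

end
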